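import Summits.QuantumFields.YangMills.Theorems.BalabanUVNodesN15KingModelBoxBlockFieldDensity
import Summits.QuantumFields.YangMills.Theorems.BalabanUVNodesN15KingModelContinuumSymbolContinuity
import Summits.QuantumFields.YangMills.Theorems.BalabanUVNodesN15KingModelContinuumSymbolAllMomenta
import HarnessLib

/-!
# BalabanUVNodes ∕ N15 — THE KING-MODEL RUNG (PART Ϟ-k): KING's CONTINUUM EFFECTIVE LAPLACIAN `Δ^{(∞)}` ON `Ω` WITH FREE BOUNDARY CONDITIONS — coordinatewise evenness of
# `Δ^{(∞)}(p′)` on the zone (by limits), `| |T̂(2n)|⁻¹ln det Δ^{(∞)}_{Πℤ∕2n} − |Ω|⁻¹ln det Δ^{(∞)}_Ω | ≤ 2B_∞·Σ_μ1∕n_μ`, and `|Ω_j|⁻¹ln det Δ^{(∞)}_{Ω_j} → bzMean(ln Δ^{(∞)})` = the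
# periodic limit (part Ε-u); `|Ω_j|⁻¹ln N_∞(Ω_j) → ½ln 2π − ½bzMean(ln Δ^{(∞)})`
# (Track A, DAG node N15 = NE2; FAN-OUT v1.1 §N15 s3 «KING-MODEL RUNG»; King p.670 l.8–13 «free boundary conditions»; count-neutral)

HONEST FRAMING.  Count-neutral (cell `pub-ymgap`, seat `pub-ymgap-dag-n15-e` g41; `--supports stmt-QuantumFields-27366 --as helper` = K3⁸).
TEMPLATE LITERATURE: C. King, Commun. Math. Phys. **102** (1986) 649–677 [King1986]: Thm 3.4 (3.9) p.656 and (3.89)–(3.93) pp.668–669 (the normalisations and their `k → ∞`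
limits), (4.5) p.670, Lemma 4.3 (4.18) p.672, §4 p.670 l.8–13.  Part Ϟ-j did the block-field density on `Ω` at finite `K`; part Ϟ-d typed `Δ^{(∞)}_Ω = fold(Δ^{(∞)})` with
`ln det Δ^{(∞)}_Ω = Σ_{k∈Ω} ln Δ^{(∞)}(p′(k̂))`; part Ε-u the torus density `|T|⁻¹ln det Δ^{(∞)}_T → bzMean(ln Δ^{(∞)})`.  THIS FILE is the `K = ∞` twin of Ϟ-j on `Ω`:
§1 ★ `effSymLim_eq_of_abs_eq` (`|p_μ| = |p′_μ|` on the zone ⇒ `Δ^{(∞)}(p) = Δ^{(∞)}(p′)` — Ϟ-i's evenness of `Δ^{(K)}` passed to the limit `K → ∞` by uniqueness of limits),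
`effSymLim_ge_floor_zone` ∕ `effSymLim_le_zone` (`δ_∞ ≤ Δ^{(∞)}(p) ≤ a` on the closed zone, by limits), `abs_log_effSymLim_le_zone` (`|ln Δ^{(∞)}| ≤ B_∞ := |ln δ_∞| + |ln a|`);
§2 ★ `effSymLim_sOf_torReflS_dblBox`, ★★ `sum_log_effSymLim_dblTorus_eq` (the doubled torus's dual tiled by the shifted half grids, for `ln Δ^{(∞)}`), ★
`log_det_foldOp_effLaplacianLim_eq_boxShiftSum`; §3 ★★★ **`abs_log_det_effLaplacianLim_dbl_div_card_sub_box_le`** (FREE vs PERIODIC for `Δ^{(∞)}` at finite volume, `≤ 2B_∞Σ_μ1∕n_μ`);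
§4 ★★★ **`tendsto_log_det_foldOp_effLaplacianLim_div_card`** (`|Ω_j|⁻¹ln det Δ^{(∞)}_{Ω_j} → bzMean(ln Δ^{(∞)})` along ANY boxes with all sides `→ ∞`), ★★★
**`tendsto_log_gaussNorm_foldOp_effLaplacianLim_div_card`** (`|Ω_j|⁻¹ln N_∞(Ω_j) → ½ln 2π − ½bzMean(ln Δ^{(∞)})`).  The two infinite-volume densities on `Ω` (scale `K`, part Ϟ-j, and
`K = ∞`, here) are the torus ones, so Ε-u's `abs_bzMean_log_DeltaEff_sub_lim_le` (`≤ C′L^{−2K}`) and `tendsto_bzMean_log_DeltaEff` apply verbatim (not restated): the limits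
`j → ∞` and `K → ∞` commute on `Ω` as on the torus.

PRIOR TREE ART (named, USED not restated): Ϟ-i∕Ϟ-j (`boxShiftSum`, `abs_boxShiftSum_sub_empty_le`, `DeltaEff_eq_of_abs_eq`, `abs_sOf_torReflS_dblBox`, `boxShiftPt_nonneg`,
`boxShiftPt_mem_zone`, `sOf_dblBox_eq_boxShiftPt`), Ϟ-d (`log_det_foldOp_effLaplacianLim`, `log_gaussNorm_foldOp_effLaplacianLim`), Ϟ-e (`card_kingBox`), Ν-b
(`sum_dblTorus_eq_sum_images`, `card_dblTorus_eq`), Ε-o (`log_det_effLaplacianLim`), Ε-u (`tendsto_log_det_effLaplacianLim_div_card`, `abs_bzMean_log_DeltaEff_sub_lim_le`), the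
continuum-symbol files (`effSymLim`, `tendsto_DeltaEff_pow_of_abs_le`, `DeltaEff_le_a`, `aInf_le_aK`, `aInf_pos`), `FreeField.DeltaEff_ge_floor`, `B5Prop11Plancherel.abs_sOf_le`.
NOT Bałaban's covariant objects; NOT a node discharge (N15 is booked through n15-a's knit, untouched); nothing continuum-YM ∕ `ℝ⁴` ∕ OS ∕ Clay.  0 `sorry`; 0 `def`.

HONEST SCOPE.  King's `A = 0` model, `L` odd `≥ 2`, `a, m² > 0`, King's coupling `a_K = aK a L K`; boxes of blocks `Ω = Π_μ{0,…,n_μ−1}` and the doubled tori `Πℤ∕2n_μ`.  The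
word «continuum» refers ONLY to King's `k → ∞` limit of the unit-lattice effective Laplacian's symbol (4.5) — a statement about one function on `[−π,π]^{d+1}`; nothing about
continuum Yang–Mills.  Locators: [King1986] Thm 3.4 (3.9) p.656, (3.89)–(3.93) pp.668–669, (4.5) p.670, Lemma 4.3 (4.18) p.672, §4 p.670 l.8–13.
-/

noncomputable section

open scoped BigOperators Topology
open Finset Filter

namespace Summit.QuantumFields.YangMills.BalabanUVNodes.N15KingModelRung.TorusSpectral

open Literature.MathematicalPhysics.QuantumFieldTheory.Balaban1983to89.B5Prop11Plancherel (Tor sOf abs_sOf_le)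
open Literature.MathematicalPhysics.QuantumFieldTheory.King1986 (aK aK_pos DeltaEff)
open Literature.MathematicalPhysics.QuantumFieldTheory.King1986.Torus
open Summit.QuantumFields.YangMills.BalabanUVNodes.N15KingModelRung.FreeField (gaussNorm DeltaEff_ge_floor)

variable {d : ℕ}

/-! ## §1 `Δ^{(∞)}` on the closed zone: coordinatewise evenness and uniform bounds, by limits -/

section Symbol

variable (L : ℕ)

/-- ★ **`Δ^{(∞)}` IS EVEN IN EACH COORDINATE ON THE ZONE**: `|p_μ| = |p′_μ| ≤ π` for all `μ` ⇒ `Δ^{(∞)}(p) = Δ^{(∞)}(p′)` (Ϟ-i's `Δ^{(K)}(p) = Δ^{(K)}(p′)` for every `K`, and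
`Δ^{(K)} → Δ^{(∞)}` pointwise on the zone). [cite: King1986, (4.5) p.670, Thm 3.4 (3.9) p.656] -/
theorem effSymLim_eq_of_abs_eq (hLodd : Odd L) (hL : 2 ≤ L) {a m2 : ℝ} (ha : 0 < a) (hm : 0 < m2) {p p' : Fin (d + 1) → ℝ} (hp : ∀ μ, |p μ| ≤ Real.pi)
    (h : ∀ μ, |p μ| = |p' μ|) : effSymLim a L m2 p = effSymLim a L m2 p' := by
  haveI : NeZero L := ⟨by omega⟩
  have hp' : ∀ μ, |p' μ| ≤ Real.pi := fun μ => (h μ) ▸ hp μ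
  have h1 := tendsto_DeltaEff_pow_of_abs_le L hLodd hL ha hm hp
  have h2 := tendsto_DeltaEff_pow_of_abs_le L hLodd hL ha hm hp'
  have heq : ∀ K : ℕ, DeltaEff (aK a L K) (L ^ K) m2 p = DeltaEff (aK a L K) (L ^ K) m2 p' := fun K => by
    haveI : NeZero (L ^ K) := ⟨pow_ne_zero _ (NeZero.ne L)⟩
    exact DeltaEff_eq_of_abs_eq _ _ _ h
  exact tendsto_nhds_unique (h1.congr heq) h2

/-- `δ_∞ := (a_∞⁻¹ + m⁻²)⁻¹ ≤ Δ^{(∞)}(p)` on the closed zone (the uniform floor of `Δ^{(K)}` passed to the limit). [cite: King1986, (4.5) p.670, (4.8) p.671] -/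
theorem effSymLim_ge_floor_zone (hLodd : Odd L) (hL : 2 ≤ L) {a m2 : ℝ} (ha : 0 < a) (hm : 0 < m2) {p : Fin (d + 1) → ℝ} (hp : ∀ μ, |p μ| ≤ Real.pi) :
    ((aInf a L)⁻¹ + m2⁻¹)⁻¹ ≤ effSymLim a L m2 p := by
  haveI : NeZero L := ⟨by omega⟩
  have hL1 : (1 : ℝ) < L := by exact_mod_cast (show 1 < L by omega)
  have haI := aInf_pos ha hL1
  refine ge_of_tendsto (tendsto_DeltaEff_pow_of_abs_le L hLodd hL ha hm hp) ?_
  filter_upwards [eventually_ge_atTop 1] with K hK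
  have haK := aK_pos ha hL1 hK
  have hfloor := DeltaEff_ge_floor (d := d + 1) haK hm (Nat.one_le_pow K L (by omega)) hp
  refine le_trans ?_ hfloor
  exact inv_anti₀ (by positivity) (add_le_add (inv_anti₀ haI (aInf_le_aK ha hL1 hK)) le_rfl)

/-- `Δ^{(∞)}(p) ≤ a` on the closed zone. [cite: King1986, (4.5) p.670, (2.13) p.653] -/
theorem effSymLim_le_zone (hLodd : Odd L) (hL : 2 ≤ L) {a m2 : ℝ} (ha : 0 < a) (hm : 0 < m2) {p : Fin (d + 1) → ℝ} (hp : ∀ μ, |p μ| ≤ Real.pi) :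
    effSymLim a L m2 p ≤ a := by
  refine le_of_tendsto (tendsto_DeltaEff_pow_of_abs_le L hLodd hL ha hm hp) ?_
  filter_upwards [eventually_ge_atTop 1] with K hK
  exact DeltaEff_le_a L hL ha hm hK p

/-- `|ln Δ^{(∞)}(p)| ≤ B_∞ := |ln δ_∞| + |ln a|` for `p ∈ [0,π]^{d+1}`. [cite: King1986, (4.5) p.670, (4.8) p.671] -/
theorem abs_log_effSymLim_le_zone (hLodd : Odd L) (hL : 2 ≤ L) {a m2 : ℝ} (ha : 0 < a) (hm : 0 < m2) (p : Fin (d + 1) → ℝ) (hp : ∀ ν, 0 ≤ p ν ∧ p ν ≤ Real.pi) :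
    |Real.log (effSymLim a L m2 p)| ≤ |Real.log (((aInf a L)⁻¹ + m2⁻¹)⁻¹)| + |Real.log a| := by
  have hL1 : (1 : ℝ) < L := by exact_mod_cast (show 1 < L by omega)
  have hp' : ∀ μ, |p μ| ≤ Real.pi := fun μ => by rw [abs_of_nonneg (hp μ).1]; exact (hp μ).2
  have hlo := effSymLim_ge_floor_zone L hLodd hL ha hm hp'
  have hhi := effSymLim_le_zone L hLodd hL ha hm hp'
  have hflo : 0 < ((aInf a L)⁻¹ + m2⁻¹)⁻¹ := by have := aInf_pos ha hL1; positivity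
  have hpos : 0 < effSymLim a L m2 p := lt_of_lt_of_le hflo hlo
  have h1 : Real.log (((aInf a L)⁻¹ + m2⁻¹)⁻¹) ≤ Real.log (effSymLim a L m2 p) := Real.log_le_log hflo hlo
  have h2 : Real.log (effSymLim a L m2 p) ≤ Real.log a := Real.log_le_log hpos hhi
  rw [abs_le]
  constructor
  · linarith [neg_abs_le (Real.log (((aInf a L)⁻¹ + m2⁻¹)⁻¹)), abs_nonneg (Real.log a)]
  · linarith [le_abs_self (Real.log a), abs_nonneg (Real.log (((aInf a L)⁻¹ + m2⁻¹)⁻¹))]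

end Symbol

/-! ## §2 The doubled torus's dual tiled by the shifted half grids, for `ln Δ^{(∞)}` -/

section Tiling

variable (L : ℕ) (n : Fin (d + 1) → ℕ) [hn : ∀ μ, NeZero (n μ)]

/-- ★ `Δ^{(∞)}(p′(σ_S k̂)) = Δ^{(∞)}(boxShiftPt S k)`. [cite: King1986, (4.5) p.670, §4 p.670] -/
theorem effSymLim_sOf_torReflS_dblBox (hLodd : Odd L) (hL : 2 ≤ L) {a m2 : ℝ} (ha : 0 < a) (hm : 0 < m2) (S : Finset (Fin (d + 1))) (k : KingBox n) :
    effSymLim a L m2 (sOf (dblPer n) (torReflS (dblPer n) S (dblBox n k))) = effSymLim a L m2 (boxShiftPt n S k) :=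
  effSymLim_eq_of_abs_eq L hLodd hL ha hm (fun μ => abs_sOf_le (dblPer n) _ μ) fun μ => by
    rw [abs_sOf_torReflS_dblBox, abs_of_nonneg (boxShiftPt_nonneg n S k μ)]
    simp only [boxShiftPt]

/-- ★★ `Σ_{q∈T̂(2n)} ln Δ^{(∞)}(p′(q)) = Σ_{S⊆{0..d}} boxShiftSum (ln Δ^{(∞)}) S` — EXACT. [cite: King1986, (4.5) p.670, §4 p.670 l.8–13] -/
theorem sum_log_effSymLim_dblTorus_eq (hLodd : Odd L) (hL : 2 ≤ L) {a m2 : ℝ} (ha : 0 < a) (hm : 0 < m2) :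
    ∑ q : Tor (dblPer n), Real.log (effSymLim a L m2 (sOf (dblPer n) q))
      = ∑ S : Finset (Fin (d + 1)), boxShiftSum n (fun p => Real.log (effSymLim a L m2 p)) S := by
  rw [sum_dblTorus_eq_sum_images n (fun q => Real.log (effSymLim a L m2 (sOf (dblPer n) q)))]
  refine Finset.sum_congr rfl fun S _ => ?_
  unfold boxShiftSum
  exact Finset.sum_congr rfl fun k _ => by rw [effSymLim_sOf_torReflS_dblBox L n hLodd hL ha hm S k]

/-- ★ `ln det Δ^{(∞)}_Ω = boxShiftSum (ln Δ^{(∞)}) ∅`. [cite: King1986, (3.89) p.668, (4.5) p.670, §4 p.670] -/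
theorem log_det_foldOp_effLaplacianLim_eq_boxShiftSum (hLodd : Odd L) (hL : 2 ≤ L) {a m2 : ℝ} (ha : 0 < a) (hm : 0 < m2) :
    Real.log (foldOp n (Matrix.of fun b b' => effLaplacianLim L (dblPer n) a m2 b b')).det = boxShiftSum n (fun p => Real.log (effSymLim a L m2 p)) ∅ := by
  rw [log_det_foldOp_effLaplacianLim L n hLodd hL ha hm]
  unfold boxShiftSum
  exact Finset.sum_congr rfl fun k _ => by rw [sOf_dblBox_eq_boxShiftPt]

end Tiling

/-! ## §3 Free versus periodic boundary conditions for `Δ^{(∞)}` at finite volume -/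

section Comparison

variable (L : ℕ) (n : Fin (d + 1) → ℕ) [hn : ∀ μ, NeZero (n μ)]

/-- ★★★ **FREE vs PERIODIC FOR `Δ^{(∞)}` AT FINITE VOLUME**: `| |T̂(2n)|⁻¹ln det Δ^{(∞)}_{Πℤ∕2n} − |Ω|⁻¹ln det Δ^{(∞)}_Ω | ≤ 2(|ln δ_∞| + |ln a|)·Σ_μ(n_μ)⁻¹`.
[cite: King1986, (3.89)–(3.93) pp.668–669, (4.5) p.670, §4 p.670 l.8–13] -/
theorem abs_log_det_effLaplacianLim_dbl_div_card_sub_box_le (hLodd : Odd L) (hL : 2 ≤ L) {a m2 : ℝ} (ha : 0 < a) (hm : 0 < m2) :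
    |(Fintype.card (Tor (dblPer n)) : ℝ)⁻¹ * Real.log (Matrix.of fun b b' => effLaplacianLim L (dblPer n) a m2 b b').det
        - (Fintype.card (KingBox n) : ℝ)⁻¹ * Real.log (foldOp n (Matrix.of fun b b' => effLaplacianLim L (dblPer n) a m2 b b')).det|
      ≤ 2 * (|Real.log (((aInf a L)⁻¹ + m2⁻¹)⁻¹)| + |Real.log a|) * ∑ μ, ((n μ : ℝ))⁻¹ := by
  set B : ℝ := |Real.log (((aInf a L)⁻¹ + m2⁻¹)⁻¹)| + |Real.log a| with hB
  set h : (Fin (d + 1) → ℝ) → ℝ := fun p => Real.log (effSymLim a L m2 p) with hh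
  have hB0 : 0 ≤ B := by positivity
  have hBh : ∀ p : Fin (d + 1) → ℝ, (∀ ν, 0 ≤ p ν ∧ p ν ≤ Real.pi) → |h p| ≤ B := fun p hp => abs_log_effSymLim_le_zone L hLodd hL ha hm p hp
  have hP : (0 : ℝ) < ∏ ν, (n ν : ℝ) := Finset.prod_pos fun ν _ => by exact_mod_cast NeZero.pos (n ν)
  have h2 : (0 : ℝ) < 2 ^ (d + 1) := by positivity
  have hT : (Fintype.card (Tor (dblPer n)) : ℝ)⁻¹ * Real.log (Matrix.of fun b b' => effLaplacianLim L (dblPer n) a m2 b b').det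
      = ((2 : ℝ) ^ (d + 1))⁻¹ * (∏ ν, (n ν : ℝ))⁻¹ * ∑ S : Finset (Fin (d + 1)), boxShiftSum n h S := by
    rw [log_det_effLaplacianLim L (dblPer n) hLodd hL ha hm, sum_log_effSymLim_dblTorus_eq L n hLodd hL ha hm, card_dblTorus_eq n, card_kingBox n]
    push_cast
    rw [mul_inv]
  have hΩ : (Fintype.card (KingBox n) : ℝ)⁻¹ * Real.log (foldOp n (Matrix.of fun b b' => effLaplacianLim L (dblPer n) a m2 b b')).det
      = ((2 : ℝ) ^ (d + 1))⁻¹ * (∏ ν, (n ν : ℝ))⁻¹ * ∑ _S : Finset (Fin (d + 1)), boxShiftSum n h ∅ := by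
    rw [log_det_foldOp_effLaplacianLim_eq_boxShiftSum L n hLodd hL ha hm, card_kingBox n, Finset.sum_const, Finset.card_univ, Fintype.card_finset, Fintype.card_fin, nsmul_eq_mul]
    push_cast
    rw [mul_mul_mul_comm, inv_mul_cancel₀ h2.ne', one_mul]
  rw [hT, hΩ, ← mul_sub, ← Finset.sum_sub_distrib, abs_mul, abs_of_pos (by positivity : (0 : ℝ) < ((2 : ℝ) ^ (d + 1))⁻¹ * (∏ ν, (n ν : ℝ))⁻¹)]
  have hsum : |∑ S : Finset (Fin (d + 1)), (boxShiftSum n h S - boxShiftSum n h ∅)| ≤ ∑ _S : Finset (Fin (d + 1)), 2 * B * (∏ ν, (n ν : ℝ)) * ∑ μ, ((n μ : ℝ))⁻¹ := by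
    refine (Finset.abs_sum_le_sum_abs _ _).trans (Finset.sum_le_sum fun S _ => ?_)
    refine (abs_boxShiftSum_sub_empty_le n h hBh S).trans ?_
    refine mul_le_mul_of_nonneg_left ?_ (by positivity)
    exact Finset.sum_le_univ_sum_of_nonneg fun μ => by positivity
  rw [Finset.sum_const, Finset.card_univ, Fintype.card_finset, Fintype.card_fin, nsmul_eq_mul] at hsum
  push_cast at hsum
  calc ((2 : ℝ) ^ (d + 1))⁻¹ * (∏ ν, (n ν : ℝ))⁻¹ * |∑ S : Finset (Fin (d + 1)), (boxShiftSum n h S - boxShiftSum n h ∅)|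
      ≤ ((2 : ℝ) ^ (d + 1))⁻¹ * (∏ ν, (n ν : ℝ))⁻¹ * (2 ^ (d + 1) * (2 * B * (∏ ν, (n ν : ℝ)) * ∑ μ, ((n μ : ℝ))⁻¹)) :=
        mul_le_mul_of_nonneg_left hsum (by positivity)
    _ = 2 * B * ∑ μ, ((n μ : ℝ))⁻¹ := by field_simp

end Comparison

/-! ## §4 The thermodynamic limit of `Δ^{(∞)}` on `Ω` equals the periodic one -/

section Limit

variable (L : ℕ)

/-- ★★★ **`|Ω_j|⁻¹·ln det Δ^{(∞)}_{Ω_j} → bzMean(ln Δ^{(∞)})`** along ANY boxes of blocks with all sides `→ ∞` (`L` odd `≥ 2`, `a, m² > 0`) — the free-boundary density of King's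
continuum effective Laplacian converges to the periodic limit of part Ε-u. [cite: King1986, Thm 3.4 (3.9) p.656, (3.89)–(3.93) pp.668–669, (4.5) p.670, §4 p.670 l.8–13] -/
theorem tendsto_log_det_foldOp_effLaplacianLim_div_card (hLodd : Odd L) (hL : 2 ≤ L) {a m2 : ℝ} (ha : 0 < a) (hm : 0 < m2) (nseq : ℕ → Fin (d + 1) → ℕ)
    (hpos : ∀ j ν, 0 < nseq j ν) (hlim : ∀ ν, Tendsto (fun j => (nseq j ν : ℝ)) atTop atTop) :
    Tendsto (fun j => haveI : ∀ ν, NeZero (nseq j ν) := fun ν => ⟨(hpos j ν).ne'⟩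
      (Fintype.card (KingBox (nseq j)) : ℝ)⁻¹ * Real.log (foldOp (nseq j) (Matrix.of fun b b' => effLaplacianLim L (dblPer (nseq j)) a m2 b b')).det) atTop
      (𝓝 (bzMean (fun p : Fin (d + 1) → ℝ => Real.log (effSymLim a L m2 p)) d)) := by
  have hT := tendsto_log_det_effLaplacianLim_div_card (d := d) L hLodd hL ha hm (fun j => dblPer (nseq j))
    (fun j ν => by simp only [dblPer]; exact Nat.mul_pos two_pos (hpos j ν))
    (fun ν => by
      have : Tendsto (fun j => (2 : ℝ) * (nseq j ν : ℝ)) atTop atTop := (hlim ν).const_mul_atTop two_pos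
      refine this.congr fun j => ?_
      simp only [dblPer]; push_cast; ring)
  have hrate : Tendsto (fun j => 2 * (|Real.log (((aInf a L)⁻¹ + m2⁻¹)⁻¹)| + |Real.log a|) * ∑ μ, ((nseq j μ : ℝ))⁻¹) atTop (𝓝 0) := by
    have h0 : Tendsto (fun j => ∑ μ, ((nseq j μ : ℝ))⁻¹) atTop (𝓝 0) := by
      have := tendsto_finsetSum (Finset.univ : Finset (Fin (d + 1))) fun μ _ => (hlim μ).inv_tendsto_atTop
      simpa using this
    simpa using h0.const_mul (2 * (|Real.log (((aInf a L)⁻¹ + m2⁻¹)⁻¹)| + |Real.log a|))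
  have hdiff : Tendsto (fun j => haveI : ∀ ν, NeZero (nseq j ν) := fun ν => ⟨(hpos j ν).ne'⟩
      (Fintype.card (Tor (dblPer (nseq j))) : ℝ)⁻¹ * Real.log (Matrix.of fun b b' => effLaplacianLim L (dblPer (nseq j)) a m2 b b').det
        - (Fintype.card (KingBox (nseq j)) : ℝ)⁻¹ * Real.log (foldOp (nseq j) (Matrix.of fun b b' => effLaplacianLim L (dblPer (nseq j)) a m2 b b')).det) atTop (𝓝 0) := by
    refine squeeze_zero_norm (fun j => ?_) hrate
    haveI : ∀ ν, NeZero (nseq j ν) := fun ν => ⟨(hpos j ν).ne'⟩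
    rw [Real.norm_eq_abs]
    exact abs_log_det_effLaplacianLim_dbl_div_card_sub_box_le L (nseq j) hLodd hL ha hm
  have h := hT.sub hdiff
  rw [sub_zero] at h
  refine h.congr fun j => ?_
  ring

/-- ★★★ **`|Ω_j|⁻¹·ln N_∞(Ω_j) → ½ln 2π − ½·bzMean(ln Δ^{(∞)})`** — King's continuum normalisation per site with free boundary conditions equals the periodic one in the
thermodynamic limit. [cite: King1986, Thm 3.4 (3.9) p.656, (3.89)–(3.93) pp.668–669, §4 p.670 l.8–13] -/
theorem tendsto_log_gaussNorm_foldOp_effLaplacianLim_div_card (hLodd : Odd L) (hL : 2 ≤ L) {a m2 : ℝ} (ha : 0 < a) (hm : 0 < m2) (nseq : ℕ → Fin (d + 1) → ℕ)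
    (hpos : ∀ j ν, 0 < nseq j ν) (hlim : ∀ ν, Tendsto (fun j => (nseq j ν : ℝ)) atTop atTop) :
    Tendsto (fun j => haveI : ∀ ν, NeZero (nseq j ν) := fun ν => ⟨(hpos j ν).ne'⟩
      (Fintype.card (KingBox (nseq j)) : ℝ)⁻¹ * Real.log (gaussNorm (foldOp (nseq j) (Matrix.of fun b b' => effLaplacianLim L (dblPer (nseq j)) a m2 b b')))) atTop
      (𝓝 (1 / 2 * Real.log (2 * Real.pi) - 1 / 2 * bzMean (fun p : Fin (d + 1) → ℝ => Real.log (effSymLim a L m2 p)) d)) := by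
  have h := tendsto_log_det_foldOp_effLaplacianLim_div_card L hLodd hL ha hm nseq hpos hlim
  have h' := (tendsto_const_nhds (x := 1 / 2 * Real.log (2 * Real.pi))).sub (h.const_mul (1 / 2))
  refine h'.congr fun j => ?_
  haveI : ∀ ν, NeZero (nseq j ν) := fun ν => ⟨(hpos j ν).ne'⟩
  have hcard : (Fintype.card (KingBox (nseq j)) : ℝ) ≠ 0 := by exact_mod_cast Fintype.card_ne_zero
  rw [log_gaussNorm_foldOp_effLaplacianLim L (nseq j) hLodd hL ha hm, ← log_det_foldOp_effLaplacianLim L (nseq j) hLodd hL ha hm, mul_sub,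
    show ((Fintype.card (KingBox (nseq j)) : ℝ))⁻¹ * ((Fintype.card (KingBox (nseq j)) : ℝ) / 2 * Real.log (2 * Real.pi)) = 1 / 2 * Real.log (2 * Real.pi) by
      rw [div_eq_mul_inv, ← mul_assoc, ← mul_assoc, inv_mul_cancel₀ hcard, one_mul]; ring]
  ring

end Limit

end Summit.QuantumFields.YangMills.BalabanUVNodes.N15KingModelRung.TorusSpectral

end
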